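import Mathlib
import Summits.NavierStokesRegularity.NavierStokesRegularity.Theorems.EulerZoomLiouvillePowerGaugeEulerLiouvilleChiralAnchorMember
import Summits.NavierStokesRegularity.NavierStokesRegularity.Theorems.EulerZoomLiouvillePowerGaugeEulerLiouvilleHelicityTubeMemberFree
import Summits.NavierStokesRegularity.NavierStokesRegularity.Theorems.EulerZoomLiouvillePowerGaugeEulerLiouvilleClassIsometryTransport
import HarnessLib

/-!
# Crux `EulerZoomLiouville.PowerGaugeEulerLiouville` (stmt-NavierStokesRegularity-19832), `stub_nonSelfSimilarRest`:
# MEMBER-LEVEL STRATA IN ANY FRAME `R ∈ O(3)` (KEY W1-AF of the LEAD ns-typeII-p2 g16; width seat ns-ezl-w1 g10)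

Route №10 `EulerZoomLiouville` (NavierStokesRegularity), crux E = stmt-NavierStokesRegularity-19832.

Frame analysis of the member-level binders named in the key (`R` a linear isometry of `ℝ³`, conjugated member `u′ = (τ,x) ↦ R u(τ, R⁻¹x)`,
`p′ = (τ,x) ↦ p(τ, R⁻¹x)`, `H′ = (τ,x) ↦ R ∘ H(τ, R⁻¹x) ∘ R⁻¹`):

* `IsAxisymSlowDrifting ρ u p` (axis `e₃` FIXED in `IsAxisymmetric`/`IsAxisymmetricScalar`) — FRAME-DEPENDENT; its any-axis member is the separate file
  `…AxisymSlowDriftingAnyAxis` (`AxisymSlowDrifting.ae_eq_zero_of_gauge_of_axisymSlowDrifting_anyAxis`).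
* `IsChiralTubePast u p`, `IsHelicalTubePast ρ u p` — mathematically FRAME-FREE: the cut-off ball `B(0,R)` and the slab/drift bounds are `O(3)`-invariant, the
  curl is a pseudo-vector (`Literature.Analysis.FluidPDE.curl_conj_linearIsometryEquiv`, `CurlIsometryCovariance`) and the helicity density a pseudo-scalar
  (`inner_self_curl_conj_linearIsometryEquiv`, `HelicityDensityPseudoscalar`), so `χ ∘ R⁻¹` is a tube datum of the conjugated slice with helicity `(det R)·h ≠ 0`
  — BOTH CHIRALITIES are already in the stratum (`≠ 0`, not `> 0`), and reflections `R` (det `−1`) are allowed below.  A formal invariance proof would need the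
  `O(3)`-covariance of `IsClassicalNSSolutionOn` (pointwise momentum equation, `timeDerivWithin`), which the tree does not hold; instead this file gives the
  `∃ R` MEMBER FORM by transport (`ClassIsometry.ae_eq_zero_of_conj`, this seat), which is what the skeleton consumes:
  `ChiralAnchor.chiralTubePast_trivial_anyFrame`, `HelicityTube.ae_eq_zero_of_gauge_of_helicalTubePast_anyFrame` (the helical stratum is contained in the
  chiral one for every `ρ`, `κ < 1` — line `chiral_anchor`'s `isChiralTubePast_of_isHelicalTubePast`; both members are kept since both binders are registered).
* `IsSymmetricWeak u H` (time-periodic ∨ travelling wave ∨ screw-symmetric modulus) — FRAME-FREE, and here the invariance IS elementary: the three senses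
  quantify over all periods `P`, all profiles/directions `(U, G₀, b)` and all screws `(L, y₀, w)`, which conjugate to `P`, `(R U R⁻¹, R G₀(R⁻¹·) R⁻¹, R b)`,
  `(R L R⁻¹, R y₀, R w)`.  Kernel receipts: `SymmetricWeak.isSymmetricWeak_conj` (symmetry of `(u, H)` ⇒ symmetry of `(u′, H′)`) and
  `SymmetricWeak.isSymmetricWeak_of_conj` (the converse), so the registered binder `¬ IsSymmetricWeak u H` ALREADY denies every frame — no widening.

WHAT THIS IS NOT: not NS, not E, not the crux: widenings (fixed frame → any frame) / invariance receipts for already killed strata of `stub_nonSelfSimilarRest`;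
19832 OPEN; no summit statement is proved by this file.
[cite: CaffarelliKohnNirenberg1982, §2; MajdaBertozziCUP2002, §1.2 Prop. 1.1 (iii)]
-/

noncomputable section

-- flat `Theorems/<Route><Decl>…` files of one crux share the namespace of the crux (tree convention)
set_option linter.dupNamespace false

open MeasureTheory Set Filter Topology Metric Function
open scoped NNReal ENNReal RealInnerProductSpace ContDiff

namespace Summit.NavierStokesRegularity.NavierStokesRegularity.Theorems.PowerGaugeEulerLiouville

open Literature.Analysis Literature.Analysis.FluidPDE

variable {u : ℝ → EuclideanSpace ℝ (Fin 3) → EuclideanSpace ℝ (Fin 3)} {p : ℝ → EuclideanSpace ℝ (Fin 3) → ℝ}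
  {H : ℝ → EuclideanSpace ℝ (Fin 3) → EuclideanSpace ℝ (Fin 3) →L[ℝ] EuclideanSpace ℝ (Fin 3)} {c : ℝ≥0}

namespace ChiralAnchor

/-- ★ **THE CHIRAL-TUBE STRATUM IS EMPTY IN ANY FRAME** (`0 < ρ`; `R ∈ O(3)`, reflections included — both chiralities): crux binders verbatim + for some
linear isometry `R` of `ℝ³` the conjugated pair `u′ = (τ,x) ↦ R u(τ, R⁻¹x)`, `p′ = (τ,x) ↦ p(τ, R⁻¹x)` is a chiral tube past (`IsChiralTubePast u′ p′` δ-unfolded,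
conjugated fields written literally: classical Euler on the open past, an anchor time `t₀ < 0` with slab bounds before it, a tube datum `(χ, R₀)` of the slice
`u′ t₀` with non-zero weighted helicity) ⇒ `u = 0` a.e. on `(−∞,0) × ℝ³`.  Proof: `ClassIsometry.ae_eq_zero_of_conj` ∘ `chiralTubePast_absurd` (ns-ezl-w3 g8,
K4 ∘ K2 ∘ K3 ∘ K1 of line `chiral_anchor`, ns-idea-11). [folklore transport; MajdaBertozziCUP2002 §1.2 Prop. 1.1 (iii)] -/
theorem chiralTubePast_trivial_anyFrame {ρ : ℝ} (hρ : 0 < ρ)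
    (hcls : IsSuitableWeakSolutionOn (slab (EuclideanSpace ℝ (Fin 3)) (Set.Iio 0) isOpen_Iio) 0 0 u p ∧
      HasWeakSpatialGradientOn (slab (EuclideanSpace ℝ (Fin 3)) (Set.Iio 0) isOpen_Iio) u H ∧
      (∀ a : ℝ, 0 < a →
        ENNReal.ofReal (a ^ (2 * ρ)) * cknA a (0 : ℝ × EuclideanSpace ℝ (Fin 3)) u +
            ENNReal.ofReal (a ^ ρ) * cknE a (0 : ℝ × EuclideanSpace ℝ (Fin 3)) H +
          ENNReal.ofReal (a ^ (2 * ρ)) * cknD a (0 : ℝ × EuclideanSpace ℝ (Fin 3)) p ≤ (c : ℝ≥0∞)))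
    (R : EuclideanSpace ℝ (Fin 3) ≃ₗᵢ[ℝ] EuclideanSpace ℝ (Fin 3))
    (hct' : IsClassicalEulerSolutionOn (Set.Iio 0) 0 (fun τ x => R (u τ (R.symm x))) (fun τ x => p τ (R.symm x)) ∧
      ∃ t₀ : ℝ, t₀ < 0 ∧
        (∀ t₁ : ℝ, t₁ < t₀ → ∃ B : ℝ, ∀ r ∈ Set.Icc t₁ t₀, ∀ x : EuclideanSpace ℝ (Fin 3),
          ‖(fun τ x => R (u τ (R.symm x))) r x‖ ≤ B) ∧
        ∃ (χ : EuclideanSpace ℝ (Fin 3) → ℝ) (R₀ : ℝ), 0 < R₀ ∧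
          (ContDiff ℝ ∞ χ ∧ (∀ x : EuclideanSpace ℝ (Fin 3), |χ x| ≤ 1) ∧
              (∀ x : EuclideanSpace ℝ (Fin 3), R₀ ≤ ‖x‖ → χ x = 0) ∧
              ∀ x : EuclideanSpace ℝ (Fin 3), fderiv ℝ χ x (curl ((fun τ x => R (u τ (R.symm x))) t₀) x) = 0) ∧
            (∫ x, χ x * ⟪(fun τ x => R (u τ (R.symm x))) t₀ x, curl ((fun τ x => R (u τ (R.symm x))) t₀) x⟫) ≠ 0) :
    uncurry u =ᵐ[volume.restrict (Set.Iio (0 : ℝ) ×ˢ (Set.univ : Set (EuclideanSpace ℝ (Fin 3))))] 0 := by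
  refine ClassIsometry.ae_eq_zero_of_conj hcls.1 hcls.2.1 hcls.2.2 R ?_
  intro u' p' H' hsw' hH' hg' hu' hp'
  subst hu' hp'
  exact (chiralTubePast_absurd ρ hρ _ _ _ c ⟨hsw', hH', hg'⟩ hct').elim

end ChiralAnchor

namespace HelicityTube

/-- ★ **THE HELICAL-TUBE STRATUM IS EMPTY IN ANY FRAME** (`0 < ρ ≤ ½`; `R ∈ O(3)`): crux binders verbatim + for some linear isometry `R` of `ℝ³` the
conjugated pair `(u′, p′)` is a helical tube past (`IsHelicalTubePast ρ u′ p′` δ-unfolded, conjugated fields written literally: classical Euler on the open past,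
drift envelope `‖u′‖ ≤ M(−τ)^{−κ}` below `T₁` with `(1−3ρ)/(2−3ρ) < κ < 1`, a tube datum of some slice `u′ τ`, `τ < T₁`, with non-zero weighted helicity)
⇒ `u = 0` a.e. on `(−∞,0) × ℝ³`.  Proof: `ClassIsometry.ae_eq_zero_of_conj` ∘ `ae_eq_zero_of_gauge_of_helicalTubePast_free`.  (Contained in the chiral
any-frame member for every `ρ`, `κ < 1`; kept because both binders are registered.) [folklore transport] -/
theorem ae_eq_zero_of_gauge_of_helicalTubePast_anyFrame {ρ : ℝ} (hρ : 0 < ρ) (hρ2 : ρ ≤ 1 / 2)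
    (hsw : IsSuitableWeakSolutionOn (slab (EuclideanSpace ℝ (Fin 3)) (Set.Iio 0) isOpen_Iio) 0 0 u p)
    (hH : HasWeakSpatialGradientOn (slab (EuclideanSpace ℝ (Fin 3)) (Set.Iio 0) isOpen_Iio) u H)
    (hgauge : ∀ a : ℝ, 0 < a →
      ENNReal.ofReal (a ^ (2 * ρ)) * cknA a (0 : ℝ × EuclideanSpace ℝ (Fin 3)) u +
          ENNReal.ofReal (a ^ ρ) * cknE a (0 : ℝ × EuclideanSpace ℝ (Fin 3)) H +
        ENNReal.ofReal (a ^ (2 * ρ)) * cknD a (0 : ℝ × EuclideanSpace ℝ (Fin 3)) p ≤ (c : ℝ≥0∞))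
    (R : EuclideanSpace ℝ (Fin 3) ≃ₗᵢ[ℝ] EuclideanSpace ℝ (Fin 3))
    (hS' : ∃ T₁ M κ : ℝ,
      (IsClassicalEulerSolutionOn (Set.Iio 0) 0 (fun τ x => R (u τ (R.symm x))) (fun τ x => p τ (R.symm x)) ∧ T₁ ≤ 0 ∧ 0 ≤ M ∧ κ < 1 ∧
          (∀ τ : ℝ, τ < T₁ → ∀ x : EuclideanSpace ℝ (Fin 3), ‖(fun τ x => R (u τ (R.symm x))) τ x‖ ≤ M * (-τ) ^ (-κ))) ∧
        (1 - 3 * ρ) / (2 - 3 * ρ) < κ ∧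
        ∃ τ : ℝ, τ < T₁ ∧ ∃ (χ : EuclideanSpace ℝ (Fin 3) → ℝ) (R₀ : ℝ), 0 < R₀ ∧
          (ContDiff ℝ ∞ χ ∧ (∀ x : EuclideanSpace ℝ (Fin 3), |χ x| ≤ 1) ∧
              (∀ x : EuclideanSpace ℝ (Fin 3), R₀ ≤ ‖x‖ → χ x = 0) ∧
              ∀ x : EuclideanSpace ℝ (Fin 3), fderiv ℝ χ x (curl ((fun τ x => R (u τ (R.symm x))) τ) x) = 0) ∧
            (∫ x, χ x * ⟪(fun τ x => R (u τ (R.symm x))) τ x, curl ((fun τ x => R (u τ (R.symm x))) τ) x⟫) ≠ 0) :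
    uncurry u =ᵐ[volume.restrict (Set.Iio (0 : ℝ) ×ˢ (Set.univ : Set (EuclideanSpace ℝ (Fin 3))))] 0 := by
  refine ClassIsometry.ae_eq_zero_of_conj hsw hH hgauge R ?_
  intro u' p' H' hsw' hH' hg' hu' hp'
  subst hu' hp'
  exact ae_eq_zero_of_gauge_of_helicalTubePast_free hρ hρ2 hsw' hH' hg' hS'

end HelicityTube

namespace SymmetricWeak

/-- **`IsSymmetricWeak` IS FRAME-FREE (forward)**: if `(u, H)` is symmetric in one of the three weak senses (time-periodic on the past ∨ travelling wave
`u(τ,y) = U(y − τb)`, `H(τ,y) = G₀(y − τb)` ∨ screw-symmetric modulus `‖u τ (L(y − y₀) + y₀ + w)‖ = ‖u τ y‖`, `w ≠ 0`, `L w = w`), then so is the conjugated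
pair `(u′, H′)` — with the same period, resp. the conjugated profile `(R U R⁻¹, R G₀(R⁻¹·) R⁻¹)` and direction `R b`, resp. the conjugated screw
`(R L R⁻¹, R y₀, R w)`.  (`IsSymmetricWeak` δ-unfolded.) [folklore] -/
theorem isSymmetricWeak_conj (R : EuclideanSpace ℝ (Fin 3) ≃ₗᵢ[ℝ] EuclideanSpace ℝ (Fin 3))
    (h : (∃ P : ℝ, 0 < P ∧ ∀ τ : ℝ, τ < 0 → u (τ - P) = u τ) ∨
      (∃ (U : EuclideanSpace ℝ (Fin 3) → EuclideanSpace ℝ (Fin 3)) (G₀ : EuclideanSpace ℝ (Fin 3) → EuclideanSpace ℝ (Fin 3) →L[ℝ] EuclideanSpace ℝ (Fin 3))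
          (b : EuclideanSpace ℝ (Fin 3)), u = (fun τ y => U (y - τ • b)) ∧ H = fun τ y => G₀ (y - τ • b)) ∨
      ∃ (L : EuclideanSpace ℝ (Fin 3) ≃ₗᵢ[ℝ] EuclideanSpace ℝ (Fin 3)) (y₀ w : EuclideanSpace ℝ (Fin 3)), w ≠ 0 ∧ L w = w ∧
        ∀ τ : ℝ, τ < 0 → ∀ y : EuclideanSpace ℝ (Fin 3), ‖u τ (L (y - y₀) + y₀ + w)‖ = ‖u τ y‖) :
    (∃ P : ℝ, 0 < P ∧ ∀ τ : ℝ, τ < 0 → (fun τ x => R (u τ (R.symm x))) (τ - P) = (fun τ x => R (u τ (R.symm x))) τ) ∨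
      (∃ (U : EuclideanSpace ℝ (Fin 3) → EuclideanSpace ℝ (Fin 3)) (G₀ : EuclideanSpace ℝ (Fin 3) → EuclideanSpace ℝ (Fin 3) →L[ℝ] EuclideanSpace ℝ (Fin 3))
          (b : EuclideanSpace ℝ (Fin 3)),
          (fun τ x => R (u τ (R.symm x))) = (fun τ y => U (y - τ • b)) ∧
            (fun τ x => (R : EuclideanSpace ℝ (Fin 3) →L[ℝ] EuclideanSpace ℝ (Fin 3)).comp
                ((H τ (R.symm x)).comp (R.symm : EuclideanSpace ℝ (Fin 3) →L[ℝ] EuclideanSpace ℝ (Fin 3)))) =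
              fun τ y => G₀ (y - τ • b)) ∨
      ∃ (L : EuclideanSpace ℝ (Fin 3) ≃ₗᵢ[ℝ] EuclideanSpace ℝ (Fin 3)) (y₀ w : EuclideanSpace ℝ (Fin 3)), w ≠ 0 ∧ L w = w ∧
        ∀ τ : ℝ, τ < 0 → ∀ y : EuclideanSpace ℝ (Fin 3),
          ‖(fun τ x => R (u τ (R.symm x))) τ (L (y - y₀) + y₀ + w)‖ = ‖(fun τ x => R (u τ (R.symm x))) τ y‖ := by
  rcases h with ⟨P, hP, hper⟩ | ⟨U, G₀, b, hu, hHb⟩ | ⟨L, y₀, w, hw, hLw, hscrew⟩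
  · -- time-periodic: the period is unchanged
    refine Or.inl ⟨P, hP, fun τ hτ => ?_⟩
    funext x
    simp only [hper τ hτ]
  · -- travelling wave: profile `R U R⁻¹`, gradient `R G₀(R⁻¹·) R⁻¹`, direction `R b`
    subst hu hHb
    refine Or.inr (Or.inl ⟨fun z => R (U (R.symm z)),
      fun z => (R : EuclideanSpace ℝ (Fin 3) →L[ℝ] EuclideanSpace ℝ (Fin 3)).comp
        ((G₀ (R.symm z)).comp (R.symm : EuclideanSpace ℝ (Fin 3) →L[ℝ] EuclideanSpace ℝ (Fin 3))),
      R b, ?_, ?_⟩)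
    · funext τ x
      simp only [map_sub, map_smul, LinearIsometryEquiv.symm_apply_apply]
    · funext τ x
      simp only [map_sub, map_smul, LinearIsometryEquiv.symm_apply_apply]
  · -- screw-symmetric modulus: screw `R L R⁻¹` about `R y₀` with pitch vector `R w`
    refine Or.inr (Or.inr ⟨R.symm.trans (L.trans R), R y₀, R w, ?_, ?_, fun τ hτ y => ?_⟩)
    · intro h0
      apply hw
      simpa using congrArg R.symm h0
    · simp [LinearIsometryEquiv.trans_apply, hLw]
    · have h1 : R.symm ((R.symm.trans (L.trans R)) (y - R y₀) + R y₀ + R w) = L (R.symm y - y₀) + y₀ + w := by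
        simp [LinearIsometryEquiv.trans_apply, map_add, map_sub]
      simp only [LinearIsometryEquiv.norm_map, h1]
      exact hscrew τ hτ (R.symm y)

/-- **`IsSymmetricWeak` IS FRAME-FREE (converse)**: symmetry of the conjugated pair `(u′, H′)` in one of the three weak senses gives symmetry of `(u, H)`
(apply `isSymmetricWeak_conj` with `R⁻¹` to the conjugated pair and undo the double conjugation).  Hence the registered binder `¬ IsSymmetricWeak u H` already
denies the stratum in EVERY frame: no `∃ R` widening is needed. [folklore] -/
theorem isSymmetricWeak_of_conj (R : EuclideanSpace ℝ (Fin 3) ≃ₗᵢ[ℝ] EuclideanSpace ℝ (Fin 3))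
    (h : (∃ P : ℝ, 0 < P ∧ ∀ τ : ℝ, τ < 0 → (fun τ x => R (u τ (R.symm x))) (τ - P) = (fun τ x => R (u τ (R.symm x))) τ) ∨
      (∃ (U : EuclideanSpace ℝ (Fin 3) → EuclideanSpace ℝ (Fin 3)) (G₀ : EuclideanSpace ℝ (Fin 3) → EuclideanSpace ℝ (Fin 3) →L[ℝ] EuclideanSpace ℝ (Fin 3))
          (b : EuclideanSpace ℝ (Fin 3)),
          (fun τ x => R (u τ (R.symm x))) = (fun τ y => U (y - τ • b)) ∧
            (fun τ x => (R : EuclideanSpace ℝ (Fin 3) →L[ℝ] EuclideanSpace ℝ (Fin 3)).comp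
                ((H τ (R.symm x)).comp (R.symm : EuclideanSpace ℝ (Fin 3) →L[ℝ] EuclideanSpace ℝ (Fin 3)))) =
              fun τ y => G₀ (y - τ • b)) ∨
      ∃ (L : EuclideanSpace ℝ (Fin 3) ≃ₗᵢ[ℝ] EuclideanSpace ℝ (Fin 3)) (y₀ w : EuclideanSpace ℝ (Fin 3)), w ≠ 0 ∧ L w = w ∧
        ∀ τ : ℝ, τ < 0 → ∀ y : EuclideanSpace ℝ (Fin 3),
          ‖(fun τ x => R (u τ (R.symm x))) τ (L (y - y₀) + y₀ + w)‖ = ‖(fun τ x => R (u τ (R.symm x))) τ y‖) :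
    (∃ P : ℝ, 0 < P ∧ ∀ τ : ℝ, τ < 0 → u (τ - P) = u τ) ∨
      (∃ (U : EuclideanSpace ℝ (Fin 3) → EuclideanSpace ℝ (Fin 3)) (G₀ : EuclideanSpace ℝ (Fin 3) → EuclideanSpace ℝ (Fin 3) →L[ℝ] EuclideanSpace ℝ (Fin 3))
          (b : EuclideanSpace ℝ (Fin 3)), u = (fun τ y => U (y - τ • b)) ∧ H = fun τ y => G₀ (y - τ • b)) ∨
      ∃ (L : EuclideanSpace ℝ (Fin 3) ≃ₗᵢ[ℝ] EuclideanSpace ℝ (Fin 3)) (y₀ w : EuclideanSpace ℝ (Fin 3)), w ≠ 0 ∧ L w = w ∧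
        ∀ τ : ℝ, τ < 0 → ∀ y : EuclideanSpace ℝ (Fin 3), ‖u τ (L (y - y₀) + y₀ + w)‖ = ‖u τ y‖ := by
  -- undo the conjugation: `u = conj_{R⁻¹} u′`, `H = conj_{R⁻¹} H′`
  have hu : u = fun τ x => R.symm ((fun τ x => R (u τ (R.symm x))) τ (R.symm.symm x)) := by
    funext τ x
    simp
  have hH : H = fun τ x => (R.symm : EuclideanSpace ℝ (Fin 3) →L[ℝ] EuclideanSpace ℝ (Fin 3)).comp
      (((fun τ x => (R : EuclideanSpace ℝ (Fin 3) →L[ℝ] EuclideanSpace ℝ (Fin 3)).comp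
          ((H τ (R.symm x)).comp (R.symm : EuclideanSpace ℝ (Fin 3) →L[ℝ] EuclideanSpace ℝ (Fin 3)))) τ (R.symm.symm x)).comp
        (R.symm.symm : EuclideanSpace ℝ (Fin 3) →L[ℝ] EuclideanSpace ℝ (Fin 3))) := by
    funext τ x
    ext v i
    simp
  have h' := isSymmetricWeak_conj (u := fun τ x => R (u τ (R.symm x)))
    (H := fun τ x => (R : EuclideanSpace ℝ (Fin 3) →L[ℝ] EuclideanSpace ℝ (Fin 3)).comp
      ((H τ (R.symm x)).comp (R.symm : EuclideanSpace ℝ (Fin 3) →L[ℝ] EuclideanSpace ℝ (Fin 3)))) R.symm h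
  rw [← hu, ← hH] at h'
  exact h'

end SymmetricWeak

end Summit.NavierStokesRegularity.NavierStokesRegularity.Theorems.PowerGaugeEulerLiouville

end
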